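import Summits.AtomisticToContinuum.Crystallization.Theorems.ChargedEnergyGapSiteStressFreeA
import HarnessLib

/-!
# «SiteStressFree» P-N (R2) designate pair (lens-3 g62) — part 2 of 2 (sequel of `…ChargedEnergyGapSiteStressFreeA`)

Split for the 400-line cap by the landing lane (hand-2 g31); the module docstring of part 1 (`…ChargedEnergyGapSiteStressFreeA`) describes the whole node.  Same namespace; all FQNs unchanged.
0 sorry; standard axioms.
-/

noncomputable section
open scoped Classical
open Literature.MathematicalPhysics.StatisticalMechanics
open Literature.Geometry.DiscreteGeometry
open Summit.AtomisticToContinuum.Crystallization.Theses.PricedLinkCensus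
open Summit.AtomisticToContinuum.Crystallization.Theorems.ChargedEnergyGapNegative

namespace Summit.AtomisticToContinuum.Crystallization.Theorems.ChargedEnergyGapChartDial

/-! ## §N4 ★★ The hypothesis block of (H𝄪ˢ) at the record dials is INHABITED -/

section WitnessS

/-- ★★ The admissibility block of (H𝄪ˢ) at the record dials `(s, lam, ℓ, μ₀) = (3/5, 1/3, 3, 1/100)` —
`IsSeparatedRef (3/5) ∧ IsLabelledRef (1/3) 3 ∧ IsForceFree ∧ IsSiteStressFree ∧ HarmStableModRot (1/100)` — is inhabited (by P-L's `fccRef a₀`, P-M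
`Fcc.exists_admissible_siteStressFree_harmStableModRot`): the piece is NOT vacuous by an empty hypothesis block. -/
theorem hypothesisBlockS_record_inhabited : ∃ P : PeriodicConfiguration 3,
    IsSeparatedRef (3 / 5) P ∧ IsLabelledRef (1 / 3) 3 P ∧ IsForceFree P ∧ IsSiteStressFree P ∧ HarmStableModRot (1 / 100) P :=
  Fcc.exists_admissible_siteStressFree_harmStableModRot

/-- … and AT that witness the rotation instance of §N2 is the discharged one: for every centre set, localisation and rotation, with the record
allowances `(C_T, Cχ) = (1/(3·10⁶), 10⁻⁵)` and any `C_H ≥ 0`. -/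
theorem fcc_rotInstance_record {C_H : ℝ} (hH : 0 ≤ C_H) (ϱχ : ℝ) {m : ℕ} (D : Fin m → Set E3) (σ : Fin m → Bool) (lamQ ϱ : ℝ) (C : Set E3)
    (S : Fin 0 → CutPiece) (r₀ v : E3) :
    -((1 / 3000000 : ℝ) * shellMassL ϱχ D σ (Fcc.fccRef Fcc.a0 Fcc.a0_pos) ∅ ϱ C) -
          (1 / 100000 : ℝ) * transMassL ϱχ D σ (Fcc.fccRef Fcc.a0 Fcc.a0_pos) ∅ ϱ C -
        C_H * (pricedNearCountL ϱχ D σ (Fcc.fccRef Fcc.a0 Fcc.a0_pos) ∅ ϱ C : ℝ) ≤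
      modelFarL ϱχ D σ (volterraField (Fcc.fccRef Fcc.a0 Fcc.a0_pos) S (rotField r₀ v)) (Fcc.fccRef Fcc.a0 Fcc.a0_pos) ∅ lamQ ϱ C :=
  localS_conclusion_rotField ϱχ D σ Fcc.isSiteStressFree_fcc (by norm_num) (by norm_num) hH lamQ ϱ C S r₀ v

end WitnessS

/-! ## §N5 ★ The symmetry toolkit for `IsSiteStressFree` (hcp-ready) -/

section Symmetry

variable {P : PeriodicConfiguration 3}

/-- ★ A stress-free reference all of whose motif site virials COINCIDE is site-stress-free: `q·T = Σ_{motif} T = 0` with `q = #motif ≥ 1`. -/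
theorem isSiteStressFree_of_forall_eq (hS : IsStressFree P) {y₁ : E3} (hy₁ : y₁ ∈ P.motif)
    (h : ∀ y ∈ P.motif, ∀ a b : E3, siteVirial P y a b = siteVirial P y₁ a b) : IsSiteStressFree P := by
  intro y hy a b
  rw [h y hy a b]
  have hsum : ∑ y ∈ P.motif, siteVirial P y a b = (P.motif.card : ℝ) * siteVirial P y₁ a b := by
    rw [Finset.sum_congr rfl fun y hy => h y hy a b, Finset.sum_const, nsmul_eq_mul]
  have hcard : (0 : ℝ) < P.motif.card := by exact_mod_cast Finset.card_pos.2 ⟨y₁, hy₁⟩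
  have h0 : (P.motif.card : ℝ) * siteVirial P y₁ a b = 0 := hsum ▸ hS a b
  rcases mul_eq_zero.1 h0 with hc | hc
  · exact absurd hc hcard.ne'
  · exact hc

/-- ★ **COVARIANCE OF THE SITE VIRIAL** under an affine isometry `q ↦ g q + c` STABILISING the point set: `T_{g y + c}(a, b) = T_y(g⁻¹ a, g⁻¹ b)`
(reindex the absolutely convergent sum by the symmetry; distances are preserved, bond vectors are rotated by `g`). -/
theorem siteVirial_symm (g : E3 ≃ₗᵢ[ℝ] E3) (c : E3) (hg : ∀ p : E3, g p + c ∈ P.points ↔ p ∈ P.points) (y a b : E3) :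
    siteVirial P (g y + c) a b = siteVirial P y (g.symm a) (g.symm b) := by
  unfold siteVirial
  let e : {z : E3 // z ∈ P.points ∧ z ≠ y} ≃ {z : E3 // z ∈ P.points ∧ z ≠ g y + c} :=
    { toFun := fun z => ⟨g z + c, (hg z).2 z.2.1, fun h => z.2.2 (g.injective (add_right_cancel h))⟩
      invFun := fun z => ⟨g.symm (z - c), by
          have h1 : g (g.symm ((z : E3) - c)) + c = z := by simp
          exact ⟨(hg _).1 (by rw [h1]; exact z.2.1), fun h => z.2.2 (by rw [← h1, h])⟩⟩
      left_inv := fun z => by ext1; simp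
      right_inv := fun z => by ext1; simp }
  rw [← e.tsum_eq]
  refine tsum_congr fun z => ?_
  have hd : dist (g y + c) (g (z : E3) + c) = dist y (z : E3) := by
    rw [dist_add_right, g.dist_map]
  have hv : g (z : E3) + c - (g y + c) = g ((z : E3) - y) := by
    rw [map_sub]; abel
  have hi : ∀ w : E3, inner ℝ (g ((z : E3) - y)) w = inner ℝ ((z : E3) - y) (g.symm w) := fun w => by
    conv_lhs => rw [← g.apply_symm_apply w]
    rw [g.inner_map_map]
  change ljD1 (dist (g y + c) (g (z : E3) + c)) / dist (g y + c) (g (z : E3) + c) *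
      (inner ℝ (g (z : E3) + c - (g y + c)) a * inner ℝ (g (z : E3) + c - (g y + c)) b) = _
  rw [hd, hv, hi a, hi b]

/-- Period translations stabilise the point set … -/
theorem add_mem_points_iff_of_mem_lattice {ℓ : E3} (hℓ : ℓ ∈ P.lattice) (p : E3) : p + ℓ ∈ P.points ↔ p ∈ P.points :=
  mem_transSet_of_mem_lattice hℓ p

/-- … so the site virial is INVARIANT under them: `T_{y + ℓ} = T_y` for `ℓ ∈ Λ_P` (the case `g = 1` of `siteVirial_symm`). -/
theorem siteVirial_add_lattice {ℓ : E3} (hℓ : ℓ ∈ P.lattice) (y a b : E3) : siteVirial P (y + ℓ) a b = siteVirial P y a b := by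
  have h := siteVirial_symm (P := P) (LinearIsometryEquiv.refl ℝ E3) ℓ (fun p => by simpa using add_mem_points_iff_of_mem_lattice hℓ p) y a b
  rw [show (LinearIsometryEquiv.refl ℝ E3).symm = LinearIsometryEquiv.refl ℝ E3 from rfl] at h
  simpa using h

/-- ★ **SITE-STRESS-FREENESS FROM MOTIF-TRANSITIVE SYMMETRY**: if the reference is stress-free and every motif site `y` is, up to a period, the
image `g y₁ + c` of ONE motif site `y₁` under an affine isometry stabilising the point set whose linear part FIXES the site virial of `y₁`
(`T_{y₁}(g a, g b) = T_{y₁}(a, b)`), then every site virial vanishes.  (hcp: `y₁ ↦ y₂` by the `6₃` screw, whose rotation part fixes the axial form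
`T_{y₁}` forced by the site symmetry `3m` — memo g62 §2.3.) -/
theorem isSiteStressFree_of_symm (hS : IsStressFree P) {y₁ : E3} (hy₁ : y₁ ∈ P.motif)
    (h : ∀ y ∈ P.motif, ∃ (g : E3 ≃ₗᵢ[ℝ] E3) (c ℓ : E3), (∀ p : E3, g p + c ∈ P.points ↔ p ∈ P.points) ∧ ℓ ∈ P.lattice ∧
      g y₁ + c = y + ℓ ∧ ∀ a b : E3, siteVirial P y₁ (g a) (g b) = siteVirial P y₁ a b) : IsSiteStressFree P := by
  refine isSiteStressFree_of_forall_eq hS hy₁ fun y hy a b => ?_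
  obtain ⟨g, c, ℓ, hg, hℓ, hy', hinv⟩ := h y hy
  have h1 : siteVirial P y a b = siteVirial P (y + ℓ) a b := (siteVirial_add_lattice hℓ y a b).symm
  rw [h1, ← hy', siteVirial_symm g c hg, ← hinv (g.symm a) (g.symm b)]
  simp

/-- Degenerate instance / consistency with P-M: for a one-point motif the symmetry hypothesis is met by the identity, recovering
`isSiteStressFree_of_motif_eq_singleton`. -/
theorem isSiteStressFree_of_symm_singleton {y₀ : E3} (hm : P.motif = {y₀}) (hS : IsStressFree P) : IsSiteStressFree P :=
  isSiteStressFree_of_symm hS (y₁ := y₀) (by simp [hm]) fun y hy => ⟨LinearIsometryEquiv.refl ℝ E3, 0, 0, fun p => by simp,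
    P.lattice.zero_mem, by rw [hm, Finset.mem_singleton] at hy; simp [hy], fun a b => by simp⟩

/-! ### ★★ Two atoms per cell: the inversion through the mid-point (hcp, and every two-point motif) -/

/-- The site virial is invariant under `(a, b) ↦ (−a, −b)` (it is bilinear). -/
theorem siteVirial_neg_neg (P : PeriodicConfiguration 3) (y a b : E3) : siteVirial P y (-a) (-b) = siteVirial P y a b := by
  simp only [siteVirial, inner_neg_right, neg_mul_neg]

/-- For a two-point motif `{A, B}` the INVERSION `q ↦ A + B − q` through the mid-point of the two sublattices STABILISES the point set (it swaps
`A + Λ_P` and `B + Λ_P`) — whatever the lattice, whatever `A, B`. -/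
theorem neg_add_mem_points_iff_of_motif_pair {A B : E3} (hm : P.motif = {A, B}) (p : E3) : -p + (A + B) ∈ P.points ↔ p ∈ P.points := by
  have hA : A ∈ P.motif := by rw [hm]; simp
  have hB : B ∈ P.motif := by rw [hm]; simp
  have key : ∀ q : E3, q ∈ P.points → -q + (A + B) ∈ P.points := by
    rintro q ⟨y, hy, g, hg, rfl⟩
    rw [hm, Finset.mem_insert, Finset.mem_singleton] at hy
    rcases hy with h | h <;> rw [h]
    · have h' := P.add_mem_points (P.mem_points_of_mem_motif hB) (P.lattice.neg_mem hg)
      convert h' using 1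
      abel
    · have h' := P.add_mem_points (P.mem_points_of_mem_motif hA) (P.lattice.neg_mem hg)
      convert h' using 1
      abel
  refine ⟨fun h => ?_, key p⟩
  have h2 := key _ h
  convert h2 using 1
  abel

/-- ★★ **TWO ATOMS PER PRIMITIVE CELL ⇒ (stress-free ⇒ SITE-stress-free)**: the inversion through the mid-point is a point-set symmetry with
linear part `−1`, which fixes every site virial; so `T_A = T_B`, and `T_A + T_B = 0` forces both to vanish.  THIS IS THE OWED hcp LEMMA (critic row
1137 (D)(v)(a)) in reference-free form: hcp has two atoms in its primitive hexagonal cell, so the stress-free hcp reference (at its equilibrium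
`(a, c)`, an admissibility obligation of the reduction anyway) IS site-stress-free — no hcp-specific computation; dhcp (four atoms per cell) is not
covered, consistently with its non-zero layer virials (census ROT-OSC). -/
theorem isSiteStressFree_of_motif_pair {A B : E3} (hm : P.motif = {A, B}) (hS : IsStressFree P) : IsSiteStressFree P := by
  have hA : A ∈ P.motif := by rw [hm]; simp
  refine isSiteStressFree_of_symm hS hA fun y hy => ?_
  rw [hm, Finset.mem_insert, Finset.mem_singleton] at hy
  rcases hy with h | h <;> rw [h]
  · exact ⟨LinearIsometryEquiv.refl ℝ E3, 0, 0, fun p => by simp, P.lattice.zero_mem, by simp, fun a b => by simp⟩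
  · refine ⟨LinearIsometryEquiv.neg ℝ, A + B, 0, fun p => ?_, P.lattice.zero_mem, ?_, fun a b => ?_⟩
    · show -p + (A + B) ∈ P.points ↔ p ∈ P.points
      exact neg_add_mem_points_iff_of_motif_pair hm p
    · show -A + (A + B) = B + 0
      abel
    · show siteVirial P A (-a) (-b) = siteVirial P A a b
      exact siteVirial_neg_neg P A a b

/-- ★★ **AT MOST TWO ATOMS PER CELL**: every stress-free periodic configuration whose motif has at most two points is site-stress-free
(one point: P-M `isSiteStressFree_of_motif_eq_singleton`; two points: the inversion). -/
theorem isSiteStressFree_of_card_motif_le_two (h2 : P.motif.card ≤ 2) (hS : IsStressFree P) : IsSiteStressFree P := by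
  have h0 : 0 < P.motif.card := Finset.card_pos.2 P.motif_nonempty
  obtain h1 | h1 : P.motif.card = 1 ∨ P.motif.card = 2 := by omega
  · obtain ⟨y₀, hy₀⟩ := Finset.card_eq_one.1 h1
    exact isSiteStressFree_of_motif_eq_singleton hy₀ hS
  · obtain ⟨A, B, -, hAB⟩ := Finset.card_eq_two.1 h1
    exact isSiteStressFree_of_motif_pair hAB hS

/-- ★★ **THE hcp LEMMA, INSTANTIATED IN THE KERNEL**: the tree's hcp periodic configuration (`hcpPeriodicConfiguration`, Literature
`BarlowStacking`: Hägg period 2, motif `{barlowPos m 0 0 : m < 2}`) is site-stress-free as soon as it is stress-free — for EVERY `(a, h)`; the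
remaining hcp obligation is only the existence of the stress-free `(a, h)` (two scalar equations; an admissibility fact the reduction needs anyway). -/
theorem hcp_isSiteStressFree_of_isStressFree {a h : ℝ} (ha : a ≠ 0) (hh : h ≠ 0) (hS : IsStressFree (hcpPeriodicConfiguration ha hh)) :
    IsSiteStressFree (hcpPeriodicConfiguration ha hh) :=
  isSiteStressFree_of_card_motif_le_two
    (show ((Finset.range 2).image fun m : ℕ => barlowPos a h alternatingHagg m 0 0).card ≤ 2 from Finset.card_image_le.trans (by simp)) hS

/-- … and the same at every Barlow periodic configuration of Hägg period `p ≤ 2` (`p = 1`: fcc presentations; `p = 2`: hcp). -/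
theorem barlow_isSiteStressFree_of_isStressFree {a h : ℝ} {s : ℤ → ℤ} {p : ℕ} (ha : a ≠ 0) (hh : h ≠ 0) (hp : p ≠ 0) (hs : ∀ i, s (i + p) = s i)
    (hp2 : p ≤ 2) (hS : IsStressFree (barlowPeriodicConfiguration s ha hh hp hs)) : IsSiteStressFree (barlowPeriodicConfiguration s ha hh hp hs) :=
  isSiteStressFree_of_card_motif_le_two
    ((show ((Finset.range p).image fun m : ℕ => barlowPos a h s m 0 0).card ≤ p from Finset.card_image_le.trans (by simp)).trans hp2) hS

end Symmetry

end Summit.AtomisticToContinuum.Crystallization.Theorems.ChargedEnergyGapChartDial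

end
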